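import Mathlib
import HarnessLib
import Summits.HubbardSuperconductivity.HubbardSuperconductivity.Theorems.KLProgrammeKLRegimeEngineLastStepResponseDoor
import Summits.HubbardSuperconductivity.HubbardSuperconductivity.Theorems.KLProgrammeKLRegimeEngineLastStepResponseBracket
import Summits.HubbardSuperconductivity.HubbardSuperconductivity.Theorems.KLProgrammeKLRegimeEngineLastStepResponseFitMulti

/-!
# K3 gen-8-FLOW (stmt 20437, stub (C), located item #20, cure (δ′) «LAST-STEP SWAP», layer F3b′): THE RESPONSE BRACKET WITH SEPARATE CONSTANTS —
# `lastResponse_bracket_multi`: the door (C2) composed with the multi-constant fit (F3a′); smallness `16·C·U ≤ 1` with the TRUE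
# `C = 2²⁹·Zω·Zt³·Za + 2³⁸·Zt²·Zb + 2³³·Zt·Zc + (ZA_a + ZA_b + ZA_c)` instead of `2⁴³·Z⁵·U ≤ 1`

Cell gate-hubbard-kl, seat p2 g17.  Same inputs as `lastResponse_bracket` (`…EngineLastStepResponseBracket`) except that the frequency window (`Zω`, natural
`1/32`), the tangential parameter (`Zt`), the three Bell tables (`Za`, `Zb`, `Zc`) and the three alias rows (`ZA_X`) carry their own constants, and the
smallness is `16·C·U ≤ 1` (`lastResponse_rows_fit_multi_of_le_klLastRespU`: from `U ≤ klLastRespU P R` whenever `16·C ≤ 2²⁵⁶·klEngPsq⁴·klEngRsq⁸·(klE3Acum²+1)²`),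
plus `2·Zt·U ≤ 1` (the profile layer's `η₀ + η ≤ 1`).  Output: LITERALLY the receiver's `(hRdiff, hR)` with `e_R = fun k => if k = 0 then 0 else 1`,
`e_R′ = fun k => if k = 0 then 1 else 0` (`heR0 := lastResponse_eR_zero`).

* `bracket_currency_facts_multi`; **`lastResponse_bracket_multi`**.

Composition only; no definitions; nothing asserts superconductivity.  Refs: BGM 2006 §2.2 (2.23), §2.4 (2.36)–(2.42) [cite: BenfattoGiulianiMastropietro2006];
FST 1996 §1 [cite: FeldmanSalmhoferTrubowitz1996].
-/

noncomputable section

namespace Summit.HubbardSuperconductivity.HubbardSuperconductivity.Theorems.EngineV8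

set_option linter.dupNamespace false -- summit = problem name (single-conjunct summit), D-0017

open Complex Real Finset Filter Literature.MathematicalPhysics.QuantumLattice Literature.Probability.LatticeModels
open Literature.Analysis.Fourier Literature.Analysis.Calculus
open Summit.HubbardSuperconductivity.HubbardSuperconductivity.Theorems.KLRegimeSplit
open Summit.HubbardSuperconductivity.HubbardSuperconductivity.Theorems.DispersionFlow
open Summit.HubbardSuperconductivity.HubbardSuperconductivity.Theorems.KLProgrammeLegKernels
open Summit.HubbardSuperconductivity.HubbardSuperconductivity.Theorems.PerturbedFermiCurve

variable {L M : ℕ} [NeZero L]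

/-! ## §1 Side facts of the multi-constant currency -/

omit [NeZero L] in
/-- `0 ≤ Zt·U/4^m`, `Zt·U/4^m + Zt·U/4^m ≤ 1`, `… ≤ 2·Zt·U/4^m`, `1 ≤ 4^m` under `0 < U`, `0 ≤ Zt`, `2·Zt·U ≤ 1`. -/
theorem bracket_currency_facts_multi {U Zt : ℝ} (hU : 0 < U) (hZt : 0 ≤ Zt) (hZtU : 2 * Zt * U ≤ 1) (m : ℕ) :
    0 ≤ Zt * U / (4 : ℝ) ^ m ∧ Zt * U / (4 : ℝ) ^ m + Zt * U / (4 : ℝ) ^ m ≤ 1 ∧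
    Zt * U / (4 : ℝ) ^ m + Zt * U / (4 : ℝ) ^ m ≤ 2 * Zt * U / (4 : ℝ) ^ m ∧ (1 : ℝ) ≤ (4 : ℝ) ^ m := by
  have hl : (1 : ℝ) ≤ (4 : ℝ) ^ m := one_le_pow₀ (by norm_num)
  have hlpos : (0 : ℝ) < (4 : ℝ) ^ m := by positivity
  refine ⟨by positivity, ?_, le_of_eq (by ring), hl⟩
  rw [← add_div, div_le_iff₀ hlpos]
  calc Zt * U + Zt * U = 2 * Zt * U := by ring
    _ ≤ 1 := hZtU
    _ ≤ 1 * (4 : ℝ) ^ m := by rw [one_mul]; exact hl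

/-! ## §2 The bracket -/


section BracketMulti

variable [NeZero M] {β : ℝ} (hβ : 0 < β) {U : ℝ} (hU : 0 < U) (μ : ℝ) (Ko Kn : TrigPolyC4v) {N : ℕ} (hN : nScales β < N)
  (hZn : IsUnit (effPartitionFn ℂ (normalCovariance L M (uvSymbolCT L M β μ Kn (klScale klE0 N)))
    (hubbardInteraction L M β U + counterQuadratic L M β Kn)))
  (hZo : IsUnit (effPartitionFn ℂ (normalCovariance L M (uvSymbolCT L M β μ Ko (klScale klE0 N)))
    (hubbardInteraction L M β U + counterQuadratic L M β Ko)))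
include hβ hU hN hZn hZo

/-- **THE RESPONSE BRACKET `(hRdiff, hR)`, SEPARATE CONSTANTS.**  See the module docstring; `m = n_β`, `N = m + 1` in the application. -/
theorem lastResponse_bracket_multi {γ : ℝ → Momentum} (hγ : ContDiff ℝ 4 γ) (hcurve : ∀ θ : ℝ, frameLevel μ Ko (γ θ) = 0)
    {Dc : ℕ → ℝ} (hDc : ∀ θ : ℝ, ∀ i, 1 ≤ i → i ≤ 4 → ‖iteratedDeriv i γ θ‖ ≤ Dc i)
    (m : ℕ) {Zω Zt Za Zb Zc ZAa ZAb ZAc : ℝ} (hZt : 0 ≤ Zt) (hZtU : 2 * Zt * U ≤ 1)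
    (hCU : 16 * (2 ^ 29 * Zω * Zt ^ 3 * Za + 2 ^ 38 * Zt ^ 2 * Zb + 2 ^ 33 * Zt * Zc + (ZAa + ZAb + ZAc)) * U ≤ 1) (hω : Real.pi / β ≤ Zω / ((4 : ℝ) ^ m))
    (ht0 : ∀ θ : ℝ, |(fun θ' : ℝ => evalM (fsub Kn Ko) (γ θ') / (Real.pi / β)) θ| ≤ Zt * U / ((4 : ℝ) ^ m))
    (htd : ∀ θ : ℝ, ∀ i, 1 ≤ i → i ≤ 4 → |iteratedDeriv i (fun θ' : ℝ => evalM (fsub Kn Ko) (γ θ') / (Real.pi / β)) θ| ≤ (Zt * U / ((4 : ℝ) ^ m)) * ((4 : ℝ) ^ m) ^ i)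
    {Mg : ℕ} (hMg : 8 ≤ Mg) {s : ℕ}
    {Dga : ℝ} (hDga : ∀ q, ‖iteratedFDeriv ℝ Mg (fun q : Momentum => ((((evalM (fsub Ko Kn) q * evalM (fsub Ko Kn) q) / (β * (L : ℝ) ^ 2) : ℝ)) : ℂ) * (((uvWeightFn (klScale klE0 N)
        (matsubaraFreq β M (omega0 M)) (frameLevel μ Ko q) : ℝ) : ℂ) * resolventFnXi (β * (L : ℝ) ^ 2) 0 (matsubaraFreq β M (omega0 M)) (frameLevel μ Ko q + uvWeightFn (klScale klE0 N)
        (matsubaraFreq β M (omega0 M)) (frameLevel μ Ko q) * evalM (fsub Ko Kn) q))) q‖ ≤ Dga) {A₀a : ℝ} (hA₀a : ∀ q, ‖(fun q : Momentum => ((((evalM (fsub Ko Kn) q * evalM (fsub Ko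
        Kn) q) / (β * (L : ℝ) ^ 2) : ℝ)) : ℂ) * (((uvWeightFn (klScale klE0 N) (matsubaraFreq β M (omega0 M)) (frameLevel μ Ko q) : ℝ) : ℂ) * resolventFnXi (β * (L : ℝ) ^ 2) 0
        (matsubaraFreq β M (omega0 M)) (frameLevel μ Ko q + uvWeightFn (klScale klE0 N) (matsubaraFreq β M (omega0 M)) (frameLevel μ Ko q) * evalM (fsub Ko Kn) q))) q‖ ≤ A₀a)
    {Mma : ℕ → ℝ} (hMma : ∀ m ≤ 4, ∑ x : TorusSite 2 L, (1 + ((x 0).valMinAbs.natAbs : ℝ) + ((x 1).valMinAbs.natAbs : ℝ)) ^ m *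
      ‖torusFourierInv (fun k => ((((fun _ : TorusSite 2 L => (1 : ℝ)) k : ℝ)) : ℂ)) x‖ ≤ Mma m)
    {Msa : ℝ} (hMsa : ∑ x : TorusSite 2 L, (1 + ((x 0).valMinAbs.natAbs : ℝ) + ((x 1).valMinAbs.natAbs : ℝ)) ^ s *
      ‖torusFourierInv (fun k => ((((fun _ : TorusSite 2 L => (1 : ℝ)) k : ℝ)) : ℂ)) x‖ ≤ Msa)
    {Dgb : ℝ} (hDgb : ∀ q, ‖iteratedFDeriv ℝ Mg (fun q : Momentum => ((((evalM (fsub Ko Kn) q / (β * (L : ℝ) ^ 2) : ℝ)) : ℂ) * (((uvWeightFn (klScale klE0 N) (matsubaraFreq β M (omega0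
        M)) (frameLevel μ Ko q) : ℝ) : ℂ) * resolventFnXi (β * (L : ℝ) ^ 2) 0 (matsubaraFreq β M (omega0 M)) (frameLevel μ Ko q + uvWeightFn (klScale klE0 N) (matsubaraFreq β M (omega0
        M)) (frameLevel μ Ko q) * evalM (fsub Ko Kn) q))) * ((((evalM (fsub Ko Kn) q / (β * (L : ℝ) ^ 2) : ℝ)) : ℂ) * (((uvWeightFn (klScale klE0 N) (matsubaraFreq β M (omega0 M))
        (frameLevel μ Ko q) : ℝ) : ℂ) * resolventFnXi (β * (L : ℝ) ^ 2) 0 (matsubaraFreq β M (omega0 M)) (frameLevel μ Ko q + uvWeightFn (klScale klE0 N) (matsubaraFreq β M (omega0 M))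
        (frameLevel μ Ko q) * evalM (fsub Ko Kn) q))) - (2 : ℂ) * ((((evalM (fsub Ko Kn) q / (β * (L : ℝ) ^ 2) : ℝ)) : ℂ) * (((uvWeightFn (klScale klE0 N) (matsubaraFreq β M (omega0
        M)) (frameLevel μ Ko q) : ℝ) : ℂ) * resolventFnXi (β * (L : ℝ) ^ 2) 0 (matsubaraFreq β M (omega0 M)) (frameLevel μ Ko q + uvWeightFn (klScale klE0 N) (matsubaraFreq β M (omega0
        M)) (frameLevel μ Ko q) * evalM (fsub Ko Kn) q)))) q‖ ≤ Dgb) {A₀b : ℝ} (hA₀b : ∀ q, ‖(fun q : Momentum => ((((evalM (fsub Ko Kn) q / (β * (L : ℝ) ^ 2) : ℝ)) : ℂ) *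
        (((uvWeightFn (klScale klE0 N) (matsubaraFreq β M (omega0 M)) (frameLevel μ Ko q) : ℝ) : ℂ) * resolventFnXi (β * (L : ℝ) ^ 2) 0 (matsubaraFreq β M (omega0 M)) (frameLevel μ Ko
        q + uvWeightFn (klScale klE0 N) (matsubaraFreq β M (omega0 M)) (frameLevel μ Ko q) * evalM (fsub Ko Kn) q))) * ((((evalM (fsub Ko Kn) q / (β * (L : ℝ) ^ 2) : ℝ)) : ℂ) *
        (((uvWeightFn (klScale klE0 N) (matsubaraFreq β M (omega0 M)) (frameLevel μ Ko q) : ℝ) : ℂ) * resolventFnXi (β * (L : ℝ) ^ 2) 0 (matsubaraFreq β M (omega0 M)) (frameLevel μ Ko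
        q + uvWeightFn (klScale klE0 N) (matsubaraFreq β M (omega0 M)) (frameLevel μ Ko q) * evalM (fsub Ko Kn) q))) - (2 : ℂ) * ((((evalM (fsub Ko Kn) q / (β * (L : ℝ) ^ 2) : ℝ)) : ℂ)
        * (((uvWeightFn (klScale klE0 N) (matsubaraFreq β M (omega0 M)) (frameLevel μ Ko q) : ℝ) : ℂ) * resolventFnXi (β * (L : ℝ) ^ 2) 0 (matsubaraFreq β M (omega0 M)) (frameLevel μ
        Ko q + uvWeightFn (klScale klE0 N) (matsubaraFreq β M (omega0 M)) (frameLevel μ Ko q) * evalM (fsub Ko Kn) q)))) q‖ ≤ A₀b)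
    {Mmb : ℕ → ℝ} (hMmb : ∀ m ≤ 4, ∑ x : TorusSite 2 L, (1 + ((x 0).valMinAbs.natAbs : ℝ) + ((x 1).valMinAbs.natAbs : ℝ)) ^ m *
      ‖torusFourierInv (fun k => ((((fun k : TorusSite 2 L => klLocSelfEnergyRe L M β U μ Kn N k) k : ℝ)) : ℂ)) x‖ ≤ Mmb m)
    {Msb : ℝ} (hMsb : ∑ x : TorusSite 2 L, (1 + ((x 0).valMinAbs.natAbs : ℝ) + ((x 1).valMinAbs.natAbs : ℝ)) ^ s *
      ‖torusFourierInv (fun k => ((((fun k : TorusSite 2 L => klLocSelfEnergyRe L M β U μ Kn N k) k : ℝ)) : ℂ)) x‖ ≤ Msb)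
    {Dgc : ℝ} (hDgc : ∀ q, ‖iteratedFDeriv ℝ Mg (fun q : Momentum => -I * (((((evalM (fsub Ko Kn) q / (β * (L : ℝ) ^ 2) : ℝ)) : ℂ) * (((uvWeightFn (klScale klE0 N) (matsubaraFreq β M
        (omega0 M)) (frameLevel μ Ko q) : ℝ) : ℂ) * resolventFnXi (β * (L : ℝ) ^ 2) 0 (matsubaraFreq β M (omega0 M)) (frameLevel μ Ko q + uvWeightFn (klScale klE0 N) (matsubaraFreq β M
        (omega0 M)) (frameLevel μ Ko q) * evalM (fsub Ko Kn) q))) * ((((evalM (fsub Ko Kn) q / (β * (L : ℝ) ^ 2) : ℝ)) : ℂ) * (((uvWeightFn (klScale klE0 N) (matsubaraFreq β M (omega0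
        M)) (frameLevel μ Ko q) : ℝ) : ℂ) * resolventFnXi (β * (L : ℝ) ^ 2) 0 (matsubaraFreq β M (omega0 M)) (frameLevel μ Ko q + uvWeightFn (klScale klE0 N) (matsubaraFreq β M (omega0
        M)) (frameLevel μ Ko q) * evalM (fsub Ko Kn) q))) - (2 : ℂ) * ((((evalM (fsub Ko Kn) q / (β * (L : ℝ) ^ 2) : ℝ)) : ℂ) * (((uvWeightFn (klScale klE0 N) (matsubaraFreq β M
        (omega0 M)) (frameLevel μ Ko q) : ℝ) : ℂ) * resolventFnXi (β * (L : ℝ) ^ 2) 0 (matsubaraFreq β M (omega0 M)) (frameLevel μ Ko q + uvWeightFn (klScale klE0 N) (matsubaraFreq β M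
        (omega0 M)) (frameLevel μ Ko q) * evalM (fsub Ko Kn) q))))) q‖ ≤ Dgc) {A₀c : ℝ} (hA₀c : ∀ q, ‖(fun q : Momentum => -I * (((((evalM (fsub Ko Kn) q / (β * (L : ℝ) ^ 2) : ℝ)) : ℂ)
        * (((uvWeightFn (klScale klE0 N) (matsubaraFreq β M (omega0 M)) (frameLevel μ Ko q) : ℝ) : ℂ) * resolventFnXi (β * (L : ℝ) ^ 2) 0 (matsubaraFreq β M (omega0 M)) (frameLevel μ
        Ko q + uvWeightFn (klScale klE0 N) (matsubaraFreq β M (omega0 M)) (frameLevel μ Ko q) * evalM (fsub Ko Kn) q))) * ((((evalM (fsub Ko Kn) q / (β * (L : ℝ) ^ 2) : ℝ)) : ℂ) *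
        (((uvWeightFn (klScale klE0 N) (matsubaraFreq β M (omega0 M)) (frameLevel μ Ko q) : ℝ) : ℂ) * resolventFnXi (β * (L : ℝ) ^ 2) 0 (matsubaraFreq β M (omega0 M)) (frameLevel μ Ko
        q + uvWeightFn (klScale klE0 N) (matsubaraFreq β M (omega0 M)) (frameLevel μ Ko q) * evalM (fsub Ko Kn) q))) - (2 : ℂ) * ((((evalM (fsub Ko Kn) q / (β * (L : ℝ) ^ 2) : ℝ)) : ℂ)
        * (((uvWeightFn (klScale klE0 N) (matsubaraFreq β M (omega0 M)) (frameLevel μ Ko q) : ℝ) : ℂ) * resolventFnXi (β * (L : ℝ) ^ 2) 0 (matsubaraFreq β M (omega0 M)) (frameLevel μ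
        Ko q + uvWeightFn (klScale klE0 N) (matsubaraFreq β M (omega0 M)) (frameLevel μ Ko q) * evalM (fsub Ko Kn) q))))) q‖ ≤ A₀c)
    {Mmc : ℕ → ℝ} (hMmc : ∀ m ≤ 4, ∑ x : TorusSite 2 L, (1 + ((x 0).valMinAbs.natAbs : ℝ) + ((x 1).valMinAbs.natAbs : ℝ)) ^ m *
      ‖torusFourierInv (fun k => ((((fun k : TorusSite 2 L => (∑ s : Fin 2, ((klSelfEnergy L M β U μ Kn klE0 N (omega0 M, k) s).im - (klSelfEnergy L M β U μ Kn klE0 N ((omega0 M).rev,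
          k) s).im)) / 4) k : ℝ)) : ℂ)) x‖ ≤ Mmc m)
    {Msc : ℝ} (hMsc : ∑ x : TorusSite 2 L, (1 + ((x 0).valMinAbs.natAbs : ℝ) + ((x 1).valMinAbs.natAbs : ℝ)) ^ s *
      ‖torusFourierInv (fun k => ((((fun k : TorusSite 2 L => (∑ s : Fin 2, ((klSelfEnergy L M β U μ Kn klE0 N (omega0 M, k) s).im - (klSelfEnergy L M β U μ Kn klE0 N ((omega0 M).rev,
          k) s).im)) / 4) k : ℝ)) : ℂ)) x‖ ≤ Msc)
    {ALa : ℕ → ℝ}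
    (hALa : ∀ j ≤ 4, 2 * (2 * (Mma j * ((3 : ℝ) ^ j * Dga * (2 / ((2 * (L / 4 + 1) : ℕ) : ℝ)) ^ (Mg - j - 4) *
        (2 ^ 2 * ∑' k : Fin 2 → ℤ, ∏ i, (1 + (k i : ℝ) ^ 2)⁻¹)))) + (L : ℝ) ^ 2 * (L : ℝ) ^ j * (A₀a * (Msa / (1 + (L : ℝ) / 4) ^ s)) ≤ ALa j)
    {PPa : ℕ → ℝ} (hPPa0 : Mma 0 ≤ PPa 0) (hPPa1 : Mma 1 * Dc 1 ≤ PPa 1) (hPPa2 : Mma 2 * Dc 1 ^ 2 + Mma 1 * Dc 2 ≤ PPa 2)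
    (hPPa3 : Mma 3 * Dc 1 ^ 3 + 3 * Mma 2 * Dc 1 * Dc 2 + Mma 1 * Dc 3 ≤ PPa 3)
    (hPPa4 : Mma 4 * Dc 1 ^ 4 + 6 * Mma 3 * Dc 1 ^ 2 * Dc 2 + 3 * Mma 2 * Dc 2 ^ 2 + 4 * Mma 2 * Dc 1 * Dc 3 + Mma 1 * Dc 4 ≤ PPa 4)
    {AAa : ℕ → ℝ} (hAAa0 : ALa 0 ≤ AAa 0) (hAAa1 : ALa 1 * Dc 1 ≤ AAa 1) (hAAa2 : ALa 2 * Dc 1 ^ 2 + ALa 1 * Dc 2 ≤ AAa 2)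
    (hAAa3 : ALa 3 * Dc 1 ^ 3 + 3 * ALa 2 * Dc 1 * Dc 2 + ALa 1 * Dc 3 ≤ AAa 3)
    (hAAa4 : ALa 4 * Dc 1 ^ 4 + 6 * ALa 3 * Dc 1 ^ 2 * Dc 2 + 3 * ALa 2 * Dc 2 ^ 2 + 4 * ALa 2 * Dc 1 * Dc 3 + ALa 1 * Dc 4 ≤ AAa 4)
    {ALb : ℕ → ℝ}
    (hALb : ∀ j ≤ 4, 2 * (2 * (Mmb j * ((3 : ℝ) ^ j * Dgb * (2 / ((2 * (L / 4 + 1) : ℕ) : ℝ)) ^ (Mg - j - 4) *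
        (2 ^ 2 * ∑' k : Fin 2 → ℤ, ∏ i, (1 + (k i : ℝ) ^ 2)⁻¹)))) + (L : ℝ) ^ 2 * (L : ℝ) ^ j * (A₀b * (Msb / (1 + (L : ℝ) / 4) ^ s)) ≤ ALb j)
    {PPb : ℕ → ℝ} (hPPb0 : Mmb 0 ≤ PPb 0) (hPPb1 : Mmb 1 * Dc 1 ≤ PPb 1) (hPPb2 : Mmb 2 * Dc 1 ^ 2 + Mmb 1 * Dc 2 ≤ PPb 2)
    (hPPb3 : Mmb 3 * Dc 1 ^ 3 + 3 * Mmb 2 * Dc 1 * Dc 2 + Mmb 1 * Dc 3 ≤ PPb 3)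
    (hPPb4 : Mmb 4 * Dc 1 ^ 4 + 6 * Mmb 3 * Dc 1 ^ 2 * Dc 2 + 3 * Mmb 2 * Dc 2 ^ 2 + 4 * Mmb 2 * Dc 1 * Dc 3 + Mmb 1 * Dc 4 ≤ PPb 4)
    {AAb : ℕ → ℝ} (hAAb0 : ALb 0 ≤ AAb 0) (hAAb1 : ALb 1 * Dc 1 ≤ AAb 1) (hAAb2 : ALb 2 * Dc 1 ^ 2 + ALb 1 * Dc 2 ≤ AAb 2)
    (hAAb3 : ALb 3 * Dc 1 ^ 3 + 3 * ALb 2 * Dc 1 * Dc 2 + ALb 1 * Dc 3 ≤ AAb 3)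
    (hAAb4 : ALb 4 * Dc 1 ^ 4 + 6 * ALb 3 * Dc 1 ^ 2 * Dc 2 + 3 * ALb 2 * Dc 2 ^ 2 + 4 * ALb 2 * Dc 1 * Dc 3 + ALb 1 * Dc 4 ≤ AAb 4)
    {ALc : ℕ → ℝ}
    (hALc : ∀ j ≤ 4, 2 * (2 * (Mmc j * ((3 : ℝ) ^ j * Dgc * (2 / ((2 * (L / 4 + 1) : ℕ) : ℝ)) ^ (Mg - j - 4) *
        (2 ^ 2 * ∑' k : Fin 2 → ℤ, ∏ i, (1 + (k i : ℝ) ^ 2)⁻¹)))) + (L : ℝ) ^ 2 * (L : ℝ) ^ j * (A₀c * (Msc / (1 + (L : ℝ) / 4) ^ s)) ≤ ALc j)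
    {PPc : ℕ → ℝ} (hPPc0 : Mmc 0 ≤ PPc 0) (hPPc1 : Mmc 1 * Dc 1 ≤ PPc 1) (hPPc2 : Mmc 2 * Dc 1 ^ 2 + Mmc 1 * Dc 2 ≤ PPc 2)
    (hPPc3 : Mmc 3 * Dc 1 ^ 3 + 3 * Mmc 2 * Dc 1 * Dc 2 + Mmc 1 * Dc 3 ≤ PPc 3)
    (hPPc4 : Mmc 4 * Dc 1 ^ 4 + 6 * Mmc 3 * Dc 1 ^ 2 * Dc 2 + 3 * Mmc 2 * Dc 2 ^ 2 + 4 * Mmc 2 * Dc 1 * Dc 3 + Mmc 1 * Dc 4 ≤ PPc 4)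
    {AAc : ℕ → ℝ} (hAAc0 : ALc 0 ≤ AAc 0) (hAAc1 : ALc 1 * Dc 1 ≤ AAc 1) (hAAc2 : ALc 2 * Dc 1 ^ 2 + ALc 1 * Dc 2 ≤ AAc 2)
    (hAAc3 : ALc 3 * Dc 1 ^ 3 + 3 * ALc 2 * Dc 1 * Dc 2 + ALc 1 * Dc 3 ≤ AAc 3)
    (hAAc4 : ALc 4 * Dc 1 ^ 4 + 6 * ALc 3 * Dc 1 ^ 2 * Dc 2 + 3 * ALc 2 * Dc 2 ^ 2 + 4 * ALc 2 * Dc 1 * Dc 3 + ALc 1 * Dc 4 ≤ AAc 4)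
    (hPPas : ∀ j ≤ 4, PPa j ≤ Za * ((4 : ℝ) ^ m) ^ j)
    (hPPbs : ∀ j ≤ 4, PPb j ≤ Zb * U * ((4 : ℝ) ^ m) ^ j)
    (hPPcs : ∀ j ≤ 4, PPc j ≤ Zc * U ^ 2 * ((4 : ℝ) ^ m) ^ j / ((4 : ℝ) ^ m))
    (hAAas : ∀ k ≤ 4, AAa k ≤ ZAa * U ^ 3 * ((4 : ℝ) ^ m) ^ k / ((4 : ℝ) ^ m) ^ 2) (hAAbs : ∀ k ≤ 4, AAb k ≤ ZAb * U ^ 3 * ((4 : ℝ) ^ m) ^ k / ((4 : ℝ) ^ m) ^ 2)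
    (hAAcs : ∀ k ≤ 4, AAc k ≤ ZAc * U ^ 3 * ((4 : ℝ) ^ m) ^ k / ((4 : ℝ) ^ m) ^ 2) :
    ContDiff ℝ 4 (fun θ : ℝ => evalM (symInterp L (fun k => klLocSelfEnergyRe L M β U μ Kn N k - Kn.eval (latticeMomentum L k))) (γ θ) -
        evalM (symInterp L (fun k => klLocSelfEnergyRe L M β U μ Ko N k - Ko.eval (latticeMomentum L k))) (γ θ)) ∧
    ∀ k ≤ 4, ∀ θ : ℝ, |iteratedDeriv k (fun θ : ℝ => evalM (symInterp L (fun k => klLocSelfEnergyRe L M β U μ Kn N k - Kn.eval (latticeMomentum L k))) (γ θ) -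
        evalM (symInterp L (fun k => klLocSelfEnergyRe L M β U μ Ko N k - Ko.eval (latticeMomentum L k))) (γ θ)) θ| ≤
      curveJetBar (fun k => if k = 0 then 0 else 1) (fun k => if k = 0 then 1 else 0) U k (m + 1) := by
  obtain ⟨hη0, h1, hA, hl⟩ := bracket_currency_facts_multi hU hZt hZtU m
  -- nonnegativity of the structural tables
  have hDc0 : ∀ i, 1 ≤ i → i ≤ 4 → 0 ≤ Dc i := fun i h1i hi4 => (norm_nonneg _).trans (hDc 0 i h1i hi4)
  have hPPa0' := bellRows_nonneg (moments_table_nonneg (fun _ : TorusSite 2 L => (1 : ℝ)) hMma) hDc0 hPPa0 hPPa1 hPPa2 hPPa3 hPPa4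
  have hPPb0' := bellRows_nonneg (moments_table_nonneg (fun k : TorusSite 2 L => klLocSelfEnergyRe L M β U μ Kn N k) hMmb) hDc0 hPPb0 hPPb1 hPPb2 hPPb3 hPPb4
  have hPPc0' := bellRows_nonneg (moments_table_nonneg (fun k : TorusSite 2 L => (∑ s : Fin 2, ((klSelfEnergy L M β U μ Kn klE0 N (omega0 M, k) s).im - (klSelfEnergy L M β U μ Kn klE0
      N ((omega0 M).rev, k) s).im)) / 4) hMmc) hDc0 hPPc0 hPPc1 hPPc2 hPPc3 hPPc4
  -- the door at every `θ`
  have hdoor := fun θ : ℝ => lastResponse_jets_door (L := L) (M := M) hβ U μ Ko Kn hN hZn hZo hγ hcurve (hDc θ) hη0 hη0 h1 hl (ht0 θ) (htd θ) hMg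
    hDga hA₀a hMma hMsa hDgb hA₀b hMmb hMsb hDgc hA₀c hMmc hMsc
    hALa hPPa0 hPPa1 hPPa2 hPPa3 hPPa4 hAAa0 hAAa1 hAAa2 hAAa3 hAAa4
    hALb hPPb0 hPPb1 hPPb2 hPPb3 hPPb4 hAAb0 hAAb1 hAAb2 hAAb3 hAAb4
    hALc hPPc0 hPPc1 hPPc2 hPPc3 hPPc4 hAAc0 hAAc1 hAAc2 hAAc3 hAAc4
  refine ⟨(hdoor 0).1, fun k hk θ => ?_⟩
  -- the fit
  have hrows := lastResponse_rows_le_multi (ω₀ := Real.pi / β) hl hη0 hη0 hA (by positivity) hω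
    hPPa0' hPPas hPPb0' hPPbs hPPc0' hPPcs hAAas hAAbs hAAcs k hk
  have hfit := lastResponse_rows_fit_curveJetBar_multi m hU hCU k hk
  exact ((hdoor θ).2 k hk).trans (hrows.trans hfit)

end BracketMulti

end Summit.HubbardSuperconductivity.HubbardSuperconductivity.Theorems.EngineV8

end
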